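import Summits.Ventures.Crystal3D.Theorems.StickyWulffConstantTextureLiminfLineCountGlueOneSided
import Summits.Ventures.Crystal3D.Theorems.StickyWulffConstantTextureLiminfFluxCountUp
import HarnessLib

/-!
# The covered wall cell from a one-sided line count along a CHOSEN-SLOT step sequence (T-side companion of K1a-at)
# (lane T, crux `TextureLiminfV5`, stmt-Ventures-23912; cf-p1 ruling 2026-08-29T03:15:18Z (a) «general-v version after 19480-p2's `_at v`»)

HONEST FRAMING. Venture `Summits/Ventures/Crystal3D` (cell `crystal3d-full`), route `route-Ventures-StickyWulffConstant`, helper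
`--supports` the law-v5 crux `TextureLiminfV5` (stmt-Ventures-23912).  Bookkeeping only, standard axioms; nothing about any wall law is
claimed beyond the stated implications; rung F-C1 not moved.

WHAT.  The chosen-slot K1a (`barlow_hlines_oriented_oneSided_at`, 19480-p2 p692347) returns, for an up-presented Δ-steep plate and a chosen
Δ-slot `v` (`v ∈ fccSlots`, `v₂ = √(2/3)`, `⟪L₁v, e₃⟫ ≥ √2/2`, clause (i) of `FramesApart` for `chainFrames e₃ L₁ v`), a step sequence with
`IsUpBond` steps, `step k = v` on Δ-bilayers, the capper rise `bilayerRise` on ∇-bilayers, and the per-cell line count.  With the engine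
`plate_lines_ge_flux_up` (…FluxCountUp: flux `√2·⟪step i, L⁻¹e⟫` per bilayer, NO selector predicate needed) the one-family cell bound and
the `BilayerWallAt` glue go through exactly as in …LineCountGlueOneSided:
* `two_charge_le_lines_oneSided_inner_up` / `…_top` — slice charge `2Q ≤ #T` for tables with `c i j ≤ √2·⟪step₁ i, L₁⁻¹e₃⟫/2`
  (resp. `≤ √2·⟪step₂ j, L₂⁻¹(−e₃)⟫/2`);
* `cell_charge_le_lines_oneSided_margin_up` / `…_top` — `2Q(wallSlice ρ) ≤ #T + 80(R₀+9)(1+h)ρ + 18mρ`;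
* `bilayerWallAt_of_lineCount_oneSided_up` / `…_top` — the K1a-at deliverable shape ⇒ `BilayerWallAt ((C_w + 80(R₀+9) + 3456 + 1152(R₀+1))/2) R₀`;
* **`bilayerWallAt_of_K1a_at`** — composed BY NAME with `barlow_hlines_oriented_oneSided_at`: the user-facing domination is
  `c i j ≤ √2·(if σ₁ i = 1 then ⟪L₁ v, e₃⟫ else bilayerRise L₁ σ₁ e₃ i)/2` (the chosen slot's flux on Δ-bilayers, the capper's on ∇-bilayers).
The top twin by name waits for 19480-p2's `barlow_hlines_oriented_oneSided_top_at` (announced); its generic layers are here.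
WHAT THIS IS NOT: no proof of any wall law or of any registered stub; F-C1 not moved.
-/

noncomputable section

namespace Summit.Ventures.Crystal3D.Theorems

open MeasureTheory Set
open scoped ENNReal InnerProductSpace
open Literature.MathematicalPhysics.StatisticalMechanics (IsHaggSeq triangularVec₁ triangularVec₂ fccStacking)
open Summit.Ventures.Crystal3D.Cruxes.TextureLiminf.TexShadow (E3 e₃ cyl stacking laySlab bilayerRise BilayerWallAt)

/-! ## The inner one-family flux counts along an `IsUpBond` step sequence -/

/-- **Inner one-family flux count, bottom plate, chosen steps.**  Plate 1 up-presented (`0 ≤ (L₁⁻¹e₃)₂`), `step₁` a sequence of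
e₃-upward bonds with rises `≥ 1/4`; a table with `c i j ≤ √2·⟪step₁ i, L₁⁻¹e₃⟫/2` has slice charge `2Q(wallSlice ρ') ≤ #T₁` for every
finite `T₁` containing the polyline's lattice lines through `[-R₀-4, -R₀-3] × {lateral ≤ ρ' + 4R₀ + 36}`. -/
theorem two_charge_le_lines_oneSided_inner_up {σ₁ : ℤ → ℤ} (hσ₁ : IsHaggSeq σ₁)
    (L₁ L₂ : E3 ≃ₗᵢ[ℝ] E3) (s₁ s₂ : E3) (R₀ ρ' : ℝ) (hR₀ : 1 ≤ R₀) (hρ' : 0 ≤ ρ') (hax₁ : 0 ≤ (L₁.symm e₃) 2)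
    {step₁ : ℤ → E3} (hup₁ : ∀ k : ℤ, IsUpBond L₁ σ₁ e₃ k (step₁ k)) (hr₁ : ∀ k : ℤ, (1 / 4 : ℝ) ≤ ⟪step₁ k, L₁.symm e₃⟫_ℝ)
    (c : ℤ → ℤ → ℝ) (hc0 : ∀ i j, 0 ≤ c i j) (hdom : ∀ i j, c i j ≤ Real.sqrt 2 * ⟪step₁ i, L₁.symm e₃⟫_ℝ / 2)
    (T₁ : Finset (Fin 2 → ℤ))
    (hT₁ : ∀ t : Fin 2 → ℤ, (∃ k : ℤ,
        -R₀ - 4 ≤ (L₁ (zigVertexS step₁ k + ((t 0 : ℝ) • triangularVec₁ 1 + (t 1 : ℝ) • triangularVec₂ 1)) + s₁) 2 ∧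
        (L₁ (zigVertexS step₁ k + ((t 0 : ℝ) • triangularVec₁ 1 + (t 1 : ℝ) • triangularVec₂ 1)) + s₁) 2 ≤ -R₀ - 3 ∧
        Real.sqrt ((L₁ (zigVertexS step₁ k + ((t 0 : ℝ) • triangularVec₁ 1 + (t 1 : ℝ) • triangularVec₂ 1)) + s₁) 0 ^ 2 +
          (L₁ (zigVertexS step₁ k + ((t 0 : ℝ) • triangularVec₁ 1 + (t 1 : ℝ) • triangularVec₂ 1)) + s₁) 1 ^ 2) ≤
          ρ' + 4 * R₀ + 36) → t ∈ T₁) :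
    2 * ∑' ij : ℤ × ℤ, c ij.1 ij.2 * (volume (wallSlice ρ' ∩ laySlab L₁ s₁ ij.1 ∩ laySlab L₂ s₂ ij.2)).toReal ≤ (T₁.card : ℝ) := by
  have he₃ : ‖(e₃ : E3)‖ = 1 := by rw [e₃, PiLp.norm_single, norm_one]
  have hi₃ : ∀ p : E3, ⟪p, e₃⟫_ℝ = p 2 := fun p => by
    rw [e₃, EuclideanSpace.inner_single_right]; simp
  have hs2 : 0 ≤ Real.sqrt 2 := Real.sqrt_nonneg 2
  have hSfin : volume (wallSlice ρ') ≠ ⊤ := by rw [volume_wallSlice ρ' hρ']; exact ENNReal.ofReal_ne_top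
  have hκ0 : ∀ i, 0 ≤ Real.sqrt 2 * ⟪step₁ i, L₁.symm e₃⟫_ℝ := fun i =>
    mul_nonneg hs2 (le_trans (by norm_num) (hr₁ i))
  have hκB : ∀ i, Real.sqrt 2 * ⟪step₁ i, L₁.symm e₃⟫_ℝ ≤ Real.sqrt 2 := fun i =>
    mul_le_of_le_one_right hs2 ((real_inner_le_norm _ _).trans
      (by rw [(hup₁ i).norm_eq_one, LinearIsometryEquiv.norm_map, he₃, one_mul]))
  have hdomκ : ∀ i j, c i j ≤ (Real.sqrt 2 * ⟪step₁ i, L₁.symm e₃⟫_ℝ + (fun _ : ℤ => (0 : ℝ)) j) / 2 := fun i j => by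
    simpa only [add_zero] using hdom i j
  have hflux := charge_le_flux L₁ L₂ s₁ s₂ (fun i => Real.sqrt 2 * ⟪step₁ i, L₁.symm e₃⟫_ℝ) (fun _ => 0) c (Real.sqrt 2)
    hκ0 hκB (fun _ => le_rfl) (fun _ => hs2) hc0 hdomκ (wallSlice ρ') (measurableSet_wallSlice ρ') hSfin
  simp only [zero_mul, tsum_zero, add_zero] at hflux
  have hsub : wallSlice ρ' ⊆ {p : E3 | (0 : ℝ) ≤ ⟪p, e₃⟫_ℝ ∧ ⟪p, e₃⟫_ℝ ≤ 0 + 1 ∧ Real.sqrt (p 0 ^ 2 + p 1 ^ 2) ≤ ρ'} := by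
    rintro p ⟨h1, h2, h3⟩
    refine ⟨by rw [hi₃]; exact h1, by rw [hi₃]; linarith, ?_⟩
    rw [← Real.sqrt_sq hρ']; exact Real.sqrt_le_sqrt h3
  have hP₁ := plate_lines_ge_flux_up hσ₁ L₁ s₁ e₃ he₃ hax₁ hup₁ hr₁ ρ' 0 (-R₀ - 4) (by linarith) (wallSlice ρ')
    (measurableSet_wallSlice ρ') hSfin hsub T₁
    (fun t ⟨k, hk1, hk2, hk3⟩ => hT₁ t ⟨k, by rw [hi₃] at hk1; linarith, by rw [hi₃] at hk2; linarith,
      hk3.trans (by linarith)⟩)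
  exact hflux.trans hP₁

/-- **Inner one-family flux count, top plate, chosen steps** (plate 2 up-presented toward `-e₃`: `0 ≤ (L₂⁻¹(−e₃))₂`; the plate-2 window
`[h+R₀+3, h+R₀+4] × {lateral ≤ ρ' + 4h + 4R₀ + 36}`). -/
theorem two_charge_le_lines_oneSided_inner_up_top {σ₂ : ℤ → ℤ} (hσ₂ : IsHaggSeq σ₂)
    (L₁ L₂ : E3 ≃ₗᵢ[ℝ] E3) (s₁ s₂ : E3) (R₀ h ρ' : ℝ) (hR₀ : 1 ≤ R₀) (hh : 0 ≤ h) (hρ' : 0 ≤ ρ')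
    (hax₂ : 0 ≤ (L₂.symm (-e₃)) 2)
    {step₂ : ℤ → E3} (hup₂ : ∀ k : ℤ, IsUpBond L₂ σ₂ (-e₃) k (step₂ k))
    (hr₂ : ∀ k : ℤ, (1 / 4 : ℝ) ≤ ⟪step₂ k, L₂.symm (-e₃)⟫_ℝ)
    (c : ℤ → ℤ → ℝ) (hc0 : ∀ i j, 0 ≤ c i j) (hdom : ∀ i j, c i j ≤ Real.sqrt 2 * ⟪step₂ j, L₂.symm (-e₃)⟫_ℝ / 2)
    (T₂ : Finset (Fin 2 → ℤ))
    (hT₂ : ∀ t : Fin 2 → ℤ, (∃ k : ℤ,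
        h + R₀ + 3 ≤ (L₂ (zigVertexS step₂ k + ((t 0 : ℝ) • triangularVec₁ 1 + (t 1 : ℝ) • triangularVec₂ 1)) + s₂) 2 ∧
        (L₂ (zigVertexS step₂ k + ((t 0 : ℝ) • triangularVec₁ 1 + (t 1 : ℝ) • triangularVec₂ 1)) + s₂) 2 ≤ h + R₀ + 4 ∧
        Real.sqrt ((L₂ (zigVertexS step₂ k + ((t 0 : ℝ) • triangularVec₁ 1 + (t 1 : ℝ) • triangularVec₂ 1)) + s₂) 0 ^ 2 +
          (L₂ (zigVertexS step₂ k + ((t 0 : ℝ) • triangularVec₁ 1 + (t 1 : ℝ) • triangularVec₂ 1)) + s₂) 1 ^ 2) ≤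
          ρ' + 4 * h + 4 * R₀ + 36) → t ∈ T₂) :
    2 * ∑' ij : ℤ × ℤ, c ij.1 ij.2 * (volume (wallSlice ρ' ∩ laySlab L₁ s₁ ij.1 ∩ laySlab L₂ s₂ ij.2)).toReal ≤ (T₂.card : ℝ) := by
  have he₃ : ‖(e₃ : E3)‖ = 1 := by rw [e₃, PiLp.norm_single, norm_one]
  have hne₃ : ‖(-e₃ : E3)‖ = 1 := by rw [norm_neg, he₃]
  have hi₃ : ∀ p : E3, ⟪p, e₃⟫_ℝ = p 2 := fun p => by
    rw [e₃, EuclideanSpace.inner_single_right]; simp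
  have hs2 : 0 ≤ Real.sqrt 2 := Real.sqrt_nonneg 2
  have hSfin : volume (wallSlice ρ') ≠ ⊤ := by rw [volume_wallSlice ρ' hρ']; exact ENNReal.ofReal_ne_top
  have hκ0 : ∀ j, 0 ≤ Real.sqrt 2 * ⟪step₂ j, L₂.symm (-e₃)⟫_ℝ := fun j =>
    mul_nonneg hs2 (le_trans (by norm_num) (hr₂ j))
  have hκB : ∀ j, Real.sqrt 2 * ⟪step₂ j, L₂.symm (-e₃)⟫_ℝ ≤ Real.sqrt 2 := fun j =>
    mul_le_of_le_one_right hs2 ((real_inner_le_norm _ _).trans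
      (by rw [(hup₂ j).norm_eq_one, LinearIsometryEquiv.norm_map, hne₃, one_mul]))
  have hdomκ : ∀ i j, c i j ≤ ((fun _ : ℤ => (0 : ℝ)) i + Real.sqrt 2 * ⟪step₂ j, L₂.symm (-e₃)⟫_ℝ) / 2 := fun i j => by
    simpa only [zero_add] using hdom i j
  have hflux := charge_le_flux L₁ L₂ s₁ s₂ (fun _ => 0) (fun j => Real.sqrt 2 * ⟪step₂ j, L₂.symm (-e₃)⟫_ℝ) c (Real.sqrt 2)
    (fun _ => le_rfl) (fun _ => hs2) hκ0 hκB hc0 hdomκ (wallSlice ρ') (measurableSet_wallSlice ρ') hSfin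
  simp only [zero_mul, tsum_zero, zero_add] at hflux
  have hsub : wallSlice ρ' ⊆ {p : E3 | (-1 : ℝ) ≤ ⟪p, -e₃⟫_ℝ ∧ ⟪p, -e₃⟫_ℝ ≤ -1 + 1 ∧ Real.sqrt (p 0 ^ 2 + p 1 ^ 2) ≤ ρ'} := by
    rintro p ⟨h1, h2, h3⟩
    refine ⟨by rw [inner_neg_right, hi₃]; linarith, by rw [inner_neg_right, hi₃]; linarith, ?_⟩
    rw [← Real.sqrt_sq hρ']; exact Real.sqrt_le_sqrt h3
  have hP₂ := plate_lines_ge_flux_up hσ₂ L₂ s₂ (-e₃) hne₃ hax₂ hup₂ hr₂ ρ' (-1) (-h - R₀ - 4) (by linarith) (wallSlice ρ')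
    (measurableSet_wallSlice ρ') hSfin hsub T₂
    (fun t ⟨k, hk1, hk2, hk3⟩ => hT₂ t ⟨k, by rw [inner_neg_right, hi₃] at hk2; linarith,
      by rw [inner_neg_right, hi₃] at hk1; linarith, hk3.trans (by linarith)⟩)
  exact hflux.trans hP₂

/-! ## The cell form: rim + margin -/

/-- **One-sided cell bound along chosen steps, bottom plate, with margin**:
`2Q(wallSlice ρ) ≤ #T₁ + 80(R₀+9)(1+h)ρ + 18mρ`. -/
theorem cell_charge_le_lines_oneSided_margin_up {σ₁ : ℤ → ℤ} (hσ₁ : IsHaggSeq σ₁)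
    (L₁ L₂ : E3 ≃ₗᵢ[ℝ] E3) (s₁ s₂ : E3) (R₀ h ρ : ℝ) (hR₀ : 1 ≤ R₀) (hh : 0 ≤ h) (hρ : 0 ≤ ρ) (hax₁ : 0 ≤ (L₁.symm e₃) 2)
    {step₁ : ℤ → E3} (hup₁ : ∀ k : ℤ, IsUpBond L₁ σ₁ e₃ k (step₁ k)) (hr₁ : ∀ k : ℤ, (1 / 4 : ℝ) ≤ ⟪step₁ k, L₁.symm e₃⟫_ℝ)
    (c : ℤ → ℤ → ℝ) (hc0 : ∀ i j, 0 ≤ c i j) (hdom : ∀ i j, c i j ≤ Real.sqrt 2 * ⟪step₁ i, L₁.symm e₃⟫_ℝ / 2)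
    (m : ℝ) (hm : 0 ≤ m) (T₁ : Finset (Fin 2 → ℤ))
    (hT₁ : ∀ t : Fin 2 → ℤ, (∃ k : ℤ,
        -R₀ - 4 ≤ (L₁ (zigVertexS step₁ k + ((t 0 : ℝ) • triangularVec₁ 1 + (t 1 : ℝ) • triangularVec₂ 1)) + s₁) 2 ∧
        (L₁ (zigVertexS step₁ k + ((t 0 : ℝ) • triangularVec₁ 1 + (t 1 : ℝ) • triangularVec₂ 1)) + s₁) 2 ≤ -R₀ - 3 ∧
        Real.sqrt ((L₁ (zigVertexS step₁ k + ((t 0 : ℝ) • triangularVec₁ 1 + (t 1 : ℝ) • triangularVec₂ 1)) + s₁) 0 ^ 2 +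
          (L₁ (zigVertexS step₁ k + ((t 0 : ℝ) • triangularVec₁ 1 + (t 1 : ℝ) • triangularVec₂ 1)) + s₁) 1 ^ 2) ≤ ρ - m) →
        t ∈ T₁) :
    2 * ∑' ij : ℤ × ℤ, c ij.1 ij.2 * (volume (wallSlice ρ ∩ laySlab L₁ s₁ ij.1 ∩ laySlab L₂ s₂ ij.2)).toReal ≤
      (T₁.card : ℝ) + 80 * (R₀ + 9) * (1 + h) * ρ + 18 * m * ρ := by
  have he₃ : ‖(e₃ : E3)‖ = 1 := by rw [e₃, PiLp.norm_single, norm_one]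
  have hs2 : 0 ≤ Real.sqrt 2 := Real.sqrt_nonneg 2
  have hκB : ∀ i, Real.sqrt 2 * ⟪step₁ i, L₁.symm e₃⟫_ℝ ≤ Real.sqrt 2 := fun i =>
    mul_le_of_le_one_right hs2 ((real_inner_le_norm _ _).trans
      (by rw [(hup₁ i).norm_eq_one, LinearIsometryEquiv.norm_map, he₃, one_mul]))
  have hcB : ∀ i j, c i j ≤ Real.sqrt 2 := fun i j => (hdom i j).trans (by linarith [hκB i])
  set d : ℝ := 4 * h + 4 * R₀ + 36 with hd
  have hd0 : 0 ≤ d := by rw [hd]; linarith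
  have hRh : 0 ≤ (R₀ + 9) * (1 + h) := mul_nonneg (by linarith) (by linarith)
  have hdle : 18 * d * ρ ≤ 80 * (R₀ + 9) * (1 + h) * ρ := by
    have h1 : 18 * d ≤ 80 * (R₀ + 9) * (1 + h) := by rw [hd]; nlinarith
    nlinarith
  have hmain := two_charge_wallSlice_le_of_inner L₁ L₂ s₁ s₂ c hc0 hcB (ρ := ρ) (M := m + d) (N := (T₁.card : ℝ)) hρ
    (by linarith) (Nat.cast_nonneg _) (fun _ =>
      two_charge_le_lines_oneSided_inner_up hσ₁ L₁ L₂ s₁ s₂ R₀ (ρ - (m + d)) hR₀ (by linarith) hax₁ hup₁ hr₁ c hc0 hdom T₁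
        (fun t ⟨k, hk1, hk2, hk3⟩ => hT₁ t ⟨k, hk1, hk2, hk3.trans (by rw [hd]; linarith)⟩))
  linarith

/-- **One-sided cell bound along chosen steps, top plate, with margin** (toward `-e₃`). -/
theorem cell_charge_le_lines_oneSided_margin_up_top {σ₂ : ℤ → ℤ} (hσ₂ : IsHaggSeq σ₂)
    (L₁ L₂ : E3 ≃ₗᵢ[ℝ] E3) (s₁ s₂ : E3) (R₀ h ρ : ℝ) (hR₀ : 1 ≤ R₀) (hh : 0 ≤ h) (hρ : 0 ≤ ρ) (hax₂ : 0 ≤ (L₂.symm (-e₃)) 2)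
    {step₂ : ℤ → E3} (hup₂ : ∀ k : ℤ, IsUpBond L₂ σ₂ (-e₃) k (step₂ k))
    (hr₂ : ∀ k : ℤ, (1 / 4 : ℝ) ≤ ⟪step₂ k, L₂.symm (-e₃)⟫_ℝ)
    (c : ℤ → ℤ → ℝ) (hc0 : ∀ i j, 0 ≤ c i j) (hdom : ∀ i j, c i j ≤ Real.sqrt 2 * ⟪step₂ j, L₂.symm (-e₃)⟫_ℝ / 2)
    (m : ℝ) (hm : 0 ≤ m) (T₂ : Finset (Fin 2 → ℤ))
    (hT₂ : ∀ t : Fin 2 → ℤ, (∃ k : ℤ,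
        h + R₀ + 3 ≤ (L₂ (zigVertexS step₂ k + ((t 0 : ℝ) • triangularVec₁ 1 + (t 1 : ℝ) • triangularVec₂ 1)) + s₂) 2 ∧
        (L₂ (zigVertexS step₂ k + ((t 0 : ℝ) • triangularVec₁ 1 + (t 1 : ℝ) • triangularVec₂ 1)) + s₂) 2 ≤ h + R₀ + 4 ∧
        Real.sqrt ((L₂ (zigVertexS step₂ k + ((t 0 : ℝ) • triangularVec₁ 1 + (t 1 : ℝ) • triangularVec₂ 1)) + s₂) 0 ^ 2 +
          (L₂ (zigVertexS step₂ k + ((t 0 : ℝ) • triangularVec₁ 1 + (t 1 : ℝ) • triangularVec₂ 1)) + s₂) 1 ^ 2) ≤ ρ - m) →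
        t ∈ T₂) :
    2 * ∑' ij : ℤ × ℤ, c ij.1 ij.2 * (volume (wallSlice ρ ∩ laySlab L₁ s₁ ij.1 ∩ laySlab L₂ s₂ ij.2)).toReal ≤
      (T₂.card : ℝ) + 80 * (R₀ + 9) * (1 + h) * ρ + 18 * m * ρ := by
  have he₃ : ‖(e₃ : E3)‖ = 1 := by rw [e₃, PiLp.norm_single, norm_one]
  have hne₃ : ‖(-e₃ : E3)‖ = 1 := by rw [norm_neg, he₃]
  have hs2 : 0 ≤ Real.sqrt 2 := Real.sqrt_nonneg 2
  have hκB : ∀ j, Real.sqrt 2 * ⟪step₂ j, L₂.symm (-e₃)⟫_ℝ ≤ Real.sqrt 2 := fun j =>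
    mul_le_of_le_one_right hs2 ((real_inner_le_norm _ _).trans
      (by rw [(hup₂ j).norm_eq_one, LinearIsometryEquiv.norm_map, hne₃, one_mul]))
  have hcB : ∀ i j, c i j ≤ Real.sqrt 2 := fun i j => (hdom i j).trans (by linarith [hκB j])
  set d : ℝ := 4 * h + 4 * R₀ + 36 with hd
  have hd0 : 0 ≤ d := by rw [hd]; linarith
  have hRh : 0 ≤ (R₀ + 9) * (1 + h) := mul_nonneg (by linarith) (by linarith)
  have hdle : 18 * d * ρ ≤ 80 * (R₀ + 9) * (1 + h) * ρ := by
    have h1 : 18 * d ≤ 80 * (R₀ + 9) * (1 + h) := by rw [hd]; nlinarith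
    nlinarith
  have hmain := two_charge_wallSlice_le_of_inner L₁ L₂ s₁ s₂ c hc0 hcB (ρ := ρ) (M := m + d) (N := (T₂.card : ℝ)) hρ
    (by linarith) (Nat.cast_nonneg _) (fun _ =>
      two_charge_le_lines_oneSided_inner_up_top hσ₂ L₁ L₂ s₁ s₂ R₀ h (ρ - (m + d)) hR₀ hh (by linarith) hax₂ hup₂ hr₂ c hc0
        hdom T₂ (fun t ⟨k, hk1, hk2, hk3⟩ => hT₂ t ⟨k, hk1, hk2, hk3.trans (by rw [hd]; linarith)⟩))
  linarith

/-! ## The K1a-at deliverable shape ⇒ the covered cell -/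

/-- **One-sided line count along chosen steps ⇒ the covered cell inequality (bottom plate).** -/
theorem bilayerWallAt_of_lineCount_oneSided_up {σ₁ σ₂ : ℤ → ℤ} (hσ₁ : IsHaggSeq σ₁) (hσ₂ : IsHaggSeq σ₂)
    (L₁ L₂ : E3 ≃ₗᵢ[ℝ] E3) (s₁ s₂ : E3) (R₀ C_w : ℝ) (hR₀ : 3 ≤ R₀) (hax₁ : 0 ≤ (L₁.symm e₃) 2)
    {step₁ : ℤ → E3} (hup₁ : ∀ k : ℤ, IsUpBond L₁ σ₁ e₃ k (step₁ k)) (hr₁ : ∀ k : ℤ, (1 / 4 : ℝ) ≤ ⟪step₁ k, L₁.symm e₃⟫_ℝ)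
    (c : ℤ → ℤ → ℝ) (hc0 : ∀ i j, 0 ≤ c i j) (hdom : ∀ i j, c i j ≤ Real.sqrt 2 * ⟪step₁ i, L₁.symm e₃⟫_ℝ / 2)
    (hF : ∀ h : ℝ, 0 ≤ h → ∀ ρ : ℝ, R₀ ≤ ρ → ∀ X P₁ P₂ : Finset E3,
      (∀ p ∈ X, ∀ q ∈ X, p ≠ q → 1 ≤ dist p q) → P₁ ⊆ X → P₂ ⊆ X \ P₁ → (∀ p ∈ X, p ∈ cyl R₀ h ρ) →
      (∀ p, p ∈ P₁ ↔ (p ∈ stacking L₁ s₁ σ₁ ∧ -(2 * R₀) ≤ p 2 ∧ p 2 ≤ -R₀ ∧ p 0 ^ 2 + p 1 ^ 2 ≤ ρ ^ 2)) →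
      (∀ p, p ∈ P₂ ↔ (p ∈ stacking L₂ s₂ σ₂ ∧ h + R₀ ≤ p 2 ∧ p 2 ≤ h + 2 * R₀ ∧ p 0 ^ 2 + p 1 ^ 2 ≤ ρ ^ 2)) →
      ∃ (m : ℝ) (T₁ : Finset (Fin 2 → ℤ)), 0 ≤ m ∧
        (∀ t : Fin 2 → ℤ, (∃ k : ℤ,
          -R₀ - 4 ≤ (L₁ (zigVertexS step₁ k + ((t 0 : ℝ) • triangularVec₁ 1 + (t 1 : ℝ) • triangularVec₂ 1)) + s₁) 2 ∧
          (L₁ (zigVertexS step₁ k + ((t 0 : ℝ) • triangularVec₁ 1 + (t 1 : ℝ) • triangularVec₂ 1)) + s₁) 2 ≤ -R₀ - 3 ∧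
          Real.sqrt ((L₁ (zigVertexS step₁ k + ((t 0 : ℝ) • triangularVec₁ 1 + (t 1 : ℝ) • triangularVec₂ 1)) + s₁) 0 ^ 2 +
            (L₁ (zigVertexS step₁ k + ((t 0 : ℝ) • triangularVec₁ 1 + (t 1 : ℝ) • triangularVec₂ 1)) + s₁) 1 ^ 2) ≤ ρ - m) →
          t ∈ T₁) ∧
        (T₁.card : ℝ) + 18 * m * ρ ≤
          (∑ y ∈ X.filter (fun y => (X.filter fun q => dist y q = 1).card ≠ 12 ∧ -R₀ - 2 ≤ y 2 ∧ y 2 ≤ h + R₀ + 2),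
            ((12 : ℝ) - ((X.filter fun q => dist y q = 1).card : ℝ))) + C_w * (1 + h) * ρ) :
    BilayerWallAt ((C_w + 80 * (R₀ + 9) + 3456 + 1152 * (R₀ + 1)) / 2) R₀ σ₁ σ₂ L₁ L₂ s₁ s₂ c := by
  classical
  have hR₀1 : 1 ≤ R₀ := by linarith
  refine bilayerWallAt_of_payerBound hσ₁ hσ₂ L₁ L₂ s₁ s₂ R₀ (C_w + 80 * (R₀ + 9)) hR₀ c ?_
  intro h hh ρ hρ X P₁ P₂ hX hP₁X hP₂X hcell hP₁ hP₂
  obtain ⟨m, T₁, hm, hT₁, hcount⟩ := hF h hh ρ hρ X P₁ P₂ hX hP₁X hP₂X hcell hP₁ hP₂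
  have hρ0 : 0 ≤ ρ := by linarith
  have hcellbound := cell_charge_le_lines_oneSided_margin_up hσ₁ L₁ L₂ s₁ s₂ R₀ h ρ hR₀1 hh hρ0 hax₁ hup₁ hr₁ c hc0 hdom
    m hm T₁ hT₁
  have hset : ({q : E3 | 0 ≤ q 2 ∧ q 2 ≤ 1 ∧ q 0 ^ 2 + q 1 ^ 2 ≤ ρ ^ 2} : Set E3) = wallSlice ρ := rfl
  rw [hset]
  have hsplit : (C_w + 80 * (R₀ + 9)) * (1 + h) * ρ = C_w * (1 + h) * ρ + 80 * (R₀ + 9) * (1 + h) * ρ := by ring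
  rw [hsplit]
  linarith

/-- **One-sided line count along chosen steps ⇒ the covered cell inequality (top plate**, toward `-e₃`). -/
theorem bilayerWallAt_of_lineCount_oneSided_up_top {σ₁ σ₂ : ℤ → ℤ} (hσ₁ : IsHaggSeq σ₁) (hσ₂ : IsHaggSeq σ₂)
    (L₁ L₂ : E3 ≃ₗᵢ[ℝ] E3) (s₁ s₂ : E3) (R₀ C_w : ℝ) (hR₀ : 3 ≤ R₀) (hax₂ : 0 ≤ (L₂.symm (-e₃)) 2)
    {step₂ : ℤ → E3} (hup₂ : ∀ k : ℤ, IsUpBond L₂ σ₂ (-e₃) k (step₂ k))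
    (hr₂ : ∀ k : ℤ, (1 / 4 : ℝ) ≤ ⟪step₂ k, L₂.symm (-e₃)⟫_ℝ)
    (c : ℤ → ℤ → ℝ) (hc0 : ∀ i j, 0 ≤ c i j) (hdom : ∀ i j, c i j ≤ Real.sqrt 2 * ⟪step₂ j, L₂.symm (-e₃)⟫_ℝ / 2)
    (hF : ∀ h : ℝ, 0 ≤ h → ∀ ρ : ℝ, R₀ ≤ ρ → ∀ X P₁ P₂ : Finset E3,
      (∀ p ∈ X, ∀ q ∈ X, p ≠ q → 1 ≤ dist p q) → P₁ ⊆ X → P₂ ⊆ X \ P₁ → (∀ p ∈ X, p ∈ cyl R₀ h ρ) →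
      (∀ p, p ∈ P₁ ↔ (p ∈ stacking L₁ s₁ σ₁ ∧ -(2 * R₀) ≤ p 2 ∧ p 2 ≤ -R₀ ∧ p 0 ^ 2 + p 1 ^ 2 ≤ ρ ^ 2)) →
      (∀ p, p ∈ P₂ ↔ (p ∈ stacking L₂ s₂ σ₂ ∧ h + R₀ ≤ p 2 ∧ p 2 ≤ h + 2 * R₀ ∧ p 0 ^ 2 + p 1 ^ 2 ≤ ρ ^ 2)) →
      ∃ (m : ℝ) (T₂ : Finset (Fin 2 → ℤ)), 0 ≤ m ∧
        (∀ t : Fin 2 → ℤ, (∃ k : ℤ,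
          h + R₀ + 3 ≤ (L₂ (zigVertexS step₂ k + ((t 0 : ℝ) • triangularVec₁ 1 + (t 1 : ℝ) • triangularVec₂ 1)) + s₂) 2 ∧
          (L₂ (zigVertexS step₂ k + ((t 0 : ℝ) • triangularVec₁ 1 + (t 1 : ℝ) • triangularVec₂ 1)) + s₂) 2 ≤ h + R₀ + 4 ∧
          Real.sqrt ((L₂ (zigVertexS step₂ k + ((t 0 : ℝ) • triangularVec₁ 1 + (t 1 : ℝ) • triangularVec₂ 1)) + s₂) 0 ^ 2 +
            (L₂ (zigVertexS step₂ k + ((t 0 : ℝ) • triangularVec₁ 1 + (t 1 : ℝ) • triangularVec₂ 1)) + s₂) 1 ^ 2) ≤ ρ - m) →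
          t ∈ T₂) ∧
        (T₂.card : ℝ) + 18 * m * ρ ≤
          (∑ y ∈ X.filter (fun y => (X.filter fun q => dist y q = 1).card ≠ 12 ∧ -R₀ - 2 ≤ y 2 ∧ y 2 ≤ h + R₀ + 2),
            ((12 : ℝ) - ((X.filter fun q => dist y q = 1).card : ℝ))) + C_w * (1 + h) * ρ) :
    BilayerWallAt ((C_w + 80 * (R₀ + 9) + 3456 + 1152 * (R₀ + 1)) / 2) R₀ σ₁ σ₂ L₁ L₂ s₁ s₂ c := by
  classical
  have hR₀1 : 1 ≤ R₀ := by linarith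
  refine bilayerWallAt_of_payerBound hσ₁ hσ₂ L₁ L₂ s₁ s₂ R₀ (C_w + 80 * (R₀ + 9)) hR₀ c ?_
  intro h hh ρ hρ X P₁ P₂ hX hP₁X hP₂X hcell hP₁ hP₂
  obtain ⟨m, T₂, hm, hT₂, hcount⟩ := hF h hh ρ hρ X P₁ P₂ hX hP₁X hP₂X hcell hP₁ hP₂
  have hρ0 : 0 ≤ ρ := by linarith
  have hcellbound := cell_charge_le_lines_oneSided_margin_up_top hσ₂ L₁ L₂ s₁ s₂ R₀ h ρ hR₀1 hh hρ0 hax₂ hup₂ hr₂ c hc0 hdom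
    m hm T₂ hT₂
  have hset : ({q : E3 | 0 ≤ q 2 ∧ q 2 ≤ 1 ∧ q 0 ^ 2 + q 1 ^ 2 ≤ ρ ^ 2} : Set E3) = wallSlice ρ := rfl
  rw [hset]
  have hsplit : (C_w + 80 * (R₀ + 9)) * (1 + h) * ρ = C_w * (1 + h) * ρ + 80 * (R₀ + 9) * (1 + h) * ρ := by ring
  rw [hsplit]
  linarith

/-! ## Composed with K1a-at by name (chosen slot, bottom plate) -/

/-- **K1a-at ⇒ the covered cell, bottom plate, CHOSEN slot `v`.**  Under lane G's E1 and star facts, for an up-presented plate 1 and a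
Δ-slot `v ∈ fccSlots` with `v₂ = √(2/3)` rising `⟪L₁ v, e₃⟫ ≥ √2/2`, whose walker chain frames `chainFrames e₃ L₁ v` are all distinct from
plate 2's frame and its twin, and `R₀ ≥ 6`: every nonnegative table dominated by half the CHOSEN flux —
`c i j ≤ √2·(if σ₁ i = 1 then ⟪L₁ v, e₃⟫ else bilayerRise L₁ σ₁ e₃ i)/2` (slot `v` on Δ-bilayers, the capper on ∇-bilayers) — satisfies
`BilayerWallAt ((318 + 192R₀ + 80(R₀+9) + 3456 + 1152(R₀+1))/2) R₀ σ₁ σ₂ L₁ L₂ s₁ s₂ c`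
(`barlow_hlines_oriented_oneSided_at`, p692347, then `bilayerWallAt_of_lineCount_oneSided_up`). -/
theorem bilayerWallAt_of_K1a_at {sE : E3} (hsE : sE ∈ fccSlots) (hcert : ExactOnly 0 (fccSlots.filter fun w => 0 < ⟪w, sE⟫_ℝ))
    (hDS : ∀ F₁ F₂ : E3 ≃ₗᵢ[ℝ] E3, DoubleStarCoaxialAt F₁ F₂) (hCP : CapPairCoaxial)
    {σ₁ σ₂ : ℤ → ℤ} (hσ₁ : IsHaggSeq σ₁) (hσ₂ : IsHaggSeq σ₂) (L₁ L₂ : E3 ≃ₗᵢ[ℝ] E3) (s₁ s₂ : E3)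
    (hax₁ : 0 ≤ (L₁.symm e₃) 2) {v : E3} (hv : v ∈ fccSlots) (hv2 : v 2 = Real.sqrt (2 / 3))
    (hsteep₁ : Real.sqrt 2 / 2 ≤ ⟪L₁ v, e₃⟫_ℝ)
    (hapart₁ : ∀ F ∈ chainFrames e₃ L₁ v,
      F '' fccStacking 1 (Real.sqrt (2 / 3)) ≠ L₂ '' fccStacking 1 (Real.sqrt (2 / 3)) ∧
      F '' fccStacking 1 (Real.sqrt (2 / 3)) ≠ (twinFrame L₂ (L₂ e₃)) '' fccStacking 1 (Real.sqrt (2 / 3)))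
    (R₀ : ℝ) (hR₀ : 6 ≤ R₀) (c : ℤ → ℤ → ℝ) (hc0 : ∀ i j, 0 ≤ c i j)
    (hdom : ∀ i j, c i j ≤ Real.sqrt 2 * (if σ₁ i = 1 then ⟪L₁ v, e₃⟫_ℝ else bilayerRise L₁ σ₁ e₃ i) / 2) :
    BilayerWallAt ((318 + 192 * R₀ + 80 * (R₀ + 9) + 3456 + 1152 * (R₀ + 1)) / 2) R₀ σ₁ σ₂ L₁ L₂ s₁ s₂ c := by
  have he₃ : ‖(e₃ : E3)‖ = 1 := by rw [e₃, PiLp.norm_single, norm_one]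
  obtain ⟨step₁, hup₁, hΔ, hnab, hF⟩ :=
    barlow_hlines_oriented_oneSided_at hsE hcert hDS hCP hσ₁ hσ₂ L₁ L₂ s₁ s₂ hax₁ hv hv2 hsteep₁ hapart₁ R₀ hR₀
  -- the rise of the chosen steps: `⟪L₁ v, e₃⟫` on Δ-bilayers, `bilayerRise` on ∇-bilayers
  have hrise : ∀ i, ⟪step₁ i, L₁.symm e₃⟫_ℝ = if σ₁ i = 1 then ⟪L₁ v, e₃⟫_ℝ else bilayerRise L₁ σ₁ e₃ i := by
    intro i
    rcases hσ₁ i with h1 | h1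
    · rw [if_pos h1, hΔ i h1, ← LinearIsometryEquiv.inner_map_map L₁ v (L₁.symm e₃), LinearIsometryEquiv.apply_symm_apply]
    · rw [if_neg (by omega)]; exact hnab i h1
  have h12 : (1 : ℝ) ≤ Real.sqrt 2 := by
    rw [show (1 : ℝ) = Real.sqrt 1 by simp]; exact Real.sqrt_le_sqrt (by norm_num)
  have hr₁ : ∀ k, (1 / 4 : ℝ) ≤ ⟪step₁ k, L₁.symm e₃⟫_ℝ := by
    intro k
    rw [hrise k]
    split_ifs with h1
    · linarith
    · exact quarter_le_bilayerRise L₁ σ₁ he₃ k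
  have hdom' : ∀ i j, c i j ≤ Real.sqrt 2 * ⟪step₁ i, L₁.symm e₃⟫_ℝ / 2 := fun i j => by rw [hrise i]; exact hdom i j
  exact bilayerWallAt_of_lineCount_oneSided_up hσ₁ hσ₂ L₁ L₂ s₁ s₂ R₀ (318 + 192 * R₀) (by linarith) hax₁ hup₁ hr₁ c hc0 hdom' hF

end Summit.Ventures.Crystal3D.Theorems

end
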